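import Literature.AlgebraicGeometry.AbelianSchemes.SerreTranslateCoverLeg                  -- ★ `idealKernelLaw_baseChangeHom`, `isMonHom_coverLeg`, `flat∕surjective∕isFinite_baseChangeHom_left`, `i_baseChange_comp_baseChangeHom`, `baseChangeHom_comp_eq_pow_id_of_comp_eq_pow_id`
import Literature.AlgebraicGeometry.AbelianSchemes.SerreTensorUntwist                       -- ★ `comp_iso_hom_eq_one_iff'` (+ ★ cover-kernel law, ★ KER-EQ descent, ★ `cancel_right_of_comp_eq_pow_id`, fppf-ness of `ψ′`)
import Literature.AlgebraicGeometry.AbelianSchemes.DualIsogenyQuasiInverse                   -- ★ `DualPair.dualIsogenyOver_comp`, `DualPair.dualIsogenyOver_congr`, `mulN_def`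
import HarnessLib

/-!
# UNTWISTING AT AN ITERATED BASE CHANGE: an `𝒪`-equivariant isomorphism `𝒞_{s₁} ≅ 𝒞_{s₂}` of two fibres of the Serre-twist family `𝒞 = 𝒜 ⊗_𝒪 𝔟`
# descends to an `𝒪`-equivariant isomorphism `𝒜_{s₁} ≅ 𝒜_{s₂}` compatible with covers, translations, exact twisted polarisations and level points

Topic `AlgebraicGeometry/AbelianSchemes`, namespace `Literature.AlgebraicGeometry.AbelianSchemes.AbelianSchemeOver`.  THEOREMS ONLY (no definition, no named fact,
no `instance`, no notation, no `sorry`); ANY base schemes `Y″ → Y′ → Y` ∕ `S₀` ∕ `T`.  Cell `hodgecm-mathlib` (D-0151), F0∕P6 «MOD» (crux hLiu418 = stmt-HodgeConjecture-24832,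
`--supports`, count-neutral), «GO 500» half A line L2 (socket `stub_DOWN` of the D-line `Cruxes/HLiu418/Lines/F0_P6a_DatumOfInputs.lean`), organ **(C1𝒞) «SERRE PULL-BACK»**
of the `stub_SPEC` ∕ [WQ] (quotient well-definedness) chain: under the «𝒞-LEG» design the reduced quotient datum of a line is a leg `A_{x̄} → 𝒞_{x̄″}` INTO the Serre-twist family
`𝒞 := 𝒜 ⊗_𝒪 𝔭_w⁻¹`, two legs with one kernel give a structured isomorphism of SERRE fibres `𝒞_{x̄₁″} ≅ 𝒞_{x̄₂″}` (★ `roof_target_unique`), and THIS file pulls it back to the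
untwisted fibres `𝒜_{x̄₁″} ≅ 𝒜_{x̄₂″}` where fine-moduli injectivity applies.  Sequel of ★ `SerreTensorUntwist` (the same statement over ONE base, through the Serre tensors
themselves) in the ITERATED-BASE-CHANGE currency `(· ×_Y Y′) ×_{Y′} sᵢ` of ★ `SerreTranslateCoverLeg` — no re-reading of the fibres as Serre tensors of the fibres (no two-step
bridge `β₂`, no equivariance of `β₂`) is needed.  HONEST LABEL: HC_CM is proved only modulo the cell's 2 remaining named inputs (hLiu418 24832, h413 24833) until rung 0 closes;
this file discharges none of them.

## Mathematics ([Conrad2004GrossZagier] §7 Thm. 7.5; [MumfordAV1970] §7 Thm. 4, §15 Thm. 1, §23; [SGA1] VIII 5.2; [MumfordFogartyKirwan1994] Ch. 7 §2)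

Let `𝒜 → Y` be an abelian scheme with an `𝒪`-action `ι`, `𝔟 = E′𝒪ᵐ` presented by `(P, Q, N)` (`E′P = P`, `QE′ = Q`, `QP = N`, `PQ = N·E′`, `N ≠ 0`) with cover package `𝔠 ∋ Q j k`
(each `a ∈ 𝔠` presented against `Q`), `𝒞 := 𝒜 ⊗_𝒪 𝔟` (★ `serreTensor`) with translation `ψ_P : 𝒜 → 𝒞` and cover `ψ′ : 𝒞 → 𝒜` (`ψ′ψ_P = [N] = ψ_Pψ′`).  Base-change along
`g : Y′ → Y` and two points `s₁, s₂ : Y″ → Y′`: `𝒜ᵢ := (𝒜 ×_Y Y′) ×_{Y′,sᵢ} Y″`, `𝒞ᵢ` likewise, `c̄ᵢ := (ψ_P)_{sᵢ}`, `c̄′ᵢ := (ψ′)_{sᵢ}`.  (§1) The cover `c̄′ᵢ` has the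
`𝒪`-INTRINSIC kernel `𝒞ᵢ[𝔠]` on all `T`-points (★ `comp_serreTranslateInv_eq_one_iff_forall_comp_serreAction_i_eq_one` base-changed twice by ★ `idealKernelLaw_baseChangeHom`).
(§2) Hence for an isomorphism `ε : 𝒞₁ ≅ 𝒞₂` of group schemes intertwining the (base-changed) Serre actions, `Ker c̄′₁ = Ker (ε ≫ c̄′₂)` and ★ KER-EQ
(`exists_iso_comp_eq_equivariant_of_comp_eq_one_iff`, [MumfordAV1970] §7 Thm. 4) descends a UNIQUE-shaped `f : 𝒜₁ ≅ 𝒜₂`, a homomorphism, `𝒪`-equivariant, with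
`c̄′₁ ≫ f = ε ≫ c̄′₂`; cancelling `[N]` gives `c̄₁ ≫ ε = f ≫ c̄₂`.  (§3) If `λ_Bᵢ : 𝒞ᵢ → B̂ᵢ` are exact twists of `λᵢ : 𝒜ᵢ → Âᵢ` (`c̄ᵢ ≫ λ_Bᵢ ≫ c̄ᵢ^∨ = λᵢ ≫ [p]`) and `ε` is exact on
`(λ_B₁, λ_B₂)` then `f` is exact on `(λ₁, λ₂)` ([MumfordAV1970] §15 Thm. 1, §23: `(c̄₁ ≫ ε)^∨ = ε^∨ ≫ c̄₁^∨`, `[p]` cancels).  (§0) Level points descend by Bezout: `u := σ₁ ≫ f`,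
`v := σ₂` with `u ≫ c̄₂ = v ≫ c̄₂`, `c̄₂ ≫ c̄′₂ = [p]`, `u^N = v^N = 1`, `gcd(p, N) = 1` ⟹ `u = v` ([MumfordFogartyKirwan1994] Ch. 7 §2 Def. 7.3).

## Contents
* §0 `eq_of_pow_eq_pow_of_coprime`, `eq_of_comp_eq_of_comp_eq_pow_id`, `comp_eq_of_comp_comp_eq` (elementary: Bezout on exponents; the level step).
* §1 `comp_coverInvLeg_eq_one_iff_forall_mem` (`Ker c̄′ = 𝒞_{Y″}[𝔠]` on all `T`-points), `i_comp_coverInvLeg` (`c̄′` is `𝒪`-equivariant).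
* §2 **`exists_untwist_baseChange₂`** — `∃ f : 𝒜₁ ≅ 𝒜₂`, `IsMonHom`, `𝒪`-equivariant, `c̄′₁ ≫ f = ε ≫ c̄′₂`, `c̄₁ ≫ ε = f ≫ c̄₂`.
* §3 **`comp_lam_comp_dualIsogenyOver_eq_of_untwist`** — `f ≫ λ₂ ≫ f^∨ = λ₁` (any base `S₀`; `IsMonHom f^∨` a binder, over a reduced locally Noetherian base ★ `DualPair.isMonHom_dualIsogenyOver`).

## References
* [MumfordAV1970] D. Mumford, *Abelian Varieties* (1970), §7 Thm. 4 (p. 72), §15 Thm. 1 (p. 143), §23 (p. 231).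
* [Conrad2004GrossZagier] B. Conrad, *Gross–Zagier revisited*, MSRI Publ. 49 (2004), §7 (Thm. 7.5).
* [MilneCM2006] J. S. Milne, *Complex Multiplication* (2006), §7 (Def. 7.19, Prop. 7.22, Rem. 7.23).
* [MumfordFogartyKirwan1994] D. Mumford, J. Fogarty, F. Kirwan, *GIT*, 3rd ed. (1994), Ch. 6 §2 Def. 6.3 (p. 120), Ch. 7 §1 Def. 7.1, §2 Def. 7.3 (p. 129).
* [GortzWedhorn2020] U. Görtz, T. Wedhorn, *Algebraic Geometry I*, 2nd ed. (2020), Definition 4.45 (2) (p. 117).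
* [Kottwitz1992] R. Kottwitz, *Points on some Shimura varieties over finite fields*, JAMS 5 (1992), §5 (p. 390).
-/

set_option autoImplicit false

noncomputable section

universe u

open CategoryTheory CategoryTheory.Limits AlgebraicGeometry MonoidalCategory CartesianMonoidalCategory
open scoped MonObj

namespace Literature.AlgebraicGeometry.AbelianSchemes

namespace AbelianSchemeOver

/-! ## §0 Elementary: Bezout on exponents; the level step -/

section Elementary

/-- Elementary, in any monoid and WITHOUT commutativity: two `N`-torsion elements with the same `n`-th power are equal when `gcd(n, N) = 1` — Bezout on the
exponents of ONE element at a time (`x = x^{n m} = (x^n)^m = (y^n)^m = y`, `n m ≡ 1 (mod N)`, Mathlib `Nat.exists_mul_mod_eq_one_of_coprime`, `pow_eq_pow_mod`).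
The monoid structure is an IMPLICIT binder `{inst}` (filled by unification from `h`, never re-synthesised).
[cite: MumfordFogartyKirwan1994, Ch. 7 §1 Definition 7.1 (p. 129)] -/
theorem eq_of_pow_eq_pow_of_coprime {M : Type*} {inst : Monoid M} {x y : M} {n N : ℕ} (hcop : n.Coprime N)
    (h : x ^ n = y ^ n) (hx : x ^ N = 1) (hy : y ^ N = 1) : x = y := by
  rcases Nat.lt_or_ge 1 N with hN1 | hN1
  · obtain ⟨m, -, hm⟩ := Nat.exists_mul_mod_eq_one_of_coprime hcop hN1
    rw [← pow_one x, ← hm, ← pow_eq_pow_mod _ hx, pow_mul, h, ← pow_mul, pow_eq_pow_mod _ hy, hm, pow_one]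
  · interval_cases N
    · have h1 : n = 1 := (Nat.coprime_zero_right n).mp hcop
      rw [h1, pow_one, pow_one] at h
      exact h
    · rw [pow_one] at hx hy
      rw [hx, hy]

/-- **`u ≫ c = v ≫ c` with `c ≫ c′ = [p]`, `u, v` `N`-torsion, `gcd(p, N) = 1` ⟹ `u = v`** (post-compose `c′`: `u^p = u ≫ [p] = v ≫ [p] = v^p`, Mathlib `MonObj.comp_pow`, then
`eq_of_pow_eq_pow_of_coprime`).  The LEVEL step of the untwist, ABSTRACT: `c` the fibre translation `ψ_P`, `c′` the fibre cover `ψ′` (`ψ_Pψ′ = [p]`), `u := σ₁ᵃ ≫ f`, `v := σ₂ᵃ` level points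
(`N`-torsion) and `f` the untwisted isomorphism. [cite: MumfordFogartyKirwan1994, Ch. 7 §2 Definition 7.3 (p. 129)] [cite: MumfordAV1970, §7 Thm. 4 (p. 72)] -/
theorem eq_of_comp_eq_of_comp_eq_pow_id {T : Scheme.{u}} {U X Y : Over T} [MonObj X] (c : X ⟶ Y) (c' : Y ⟶ X) {p N : ℕ}
    (hcc' : c ≫ c' = (𝟙 X) ^ p) (hcop : p.Coprime N) {u v : U ⟶ X} (h : u ≫ c = v ≫ c) (hu : u ^ N = 1) (hv : v ^ N = 1) : u = v := by
  have hp : u ^ p = v ^ p := by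
    rw [← Category.comp_id u, ← Category.comp_id v, ← MonObj.comp_pow, ← MonObj.comp_pow, ← hcc', ← Category.assoc, h, Category.assoc]
  exact eq_of_pow_eq_pow_of_coprime hcop hp hu hv

/-- The same with `u := σ₁ ≫ f` for a homomorphism `f` and `σ₁` `N`-torsion (`(σ₁ ≫ f)^N = σ₁^N ≫ f = 1`, Mathlib `MonObj.pow_comp`) — the shape in which a
level structure descends along the untwisted isomorphism `f` (`σᵢ := σᵃ(xᵢ)` the level points, `c, c′` the fibre translation and cover at `x₂`). [cite: MumfordFogartyKirwan1994, Ch. 7 §2 Definition 7.3 (p. 129)] -/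
theorem comp_eq_of_comp_comp_eq {T : Scheme.{u}} {U X₁ X₂ Y : Over T} [MonObj X₁] [MonObj X₂] (f : X₁ ⟶ X₂) [IsMonHom f]
    (c : X₂ ⟶ Y) (c' : Y ⟶ X₂) {p N : ℕ} (hcc' : c ≫ c' = (𝟙 X₂) ^ p) (hcop : p.Coprime N)
    {σ₁ : U ⟶ X₁} {σ₂ : U ⟶ X₂} (h : (σ₁ ≫ f) ≫ c = σ₂ ≫ c) (hσ₁ : σ₁ ^ N = 1) (hσ₂ : σ₂ ^ N = 1) : σ₁ ≫ f = σ₂ :=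
  eq_of_comp_eq_of_comp_eq_pow_id c c' hcc' hcop h (by rw [← MonObj.pow_comp, hσ₁, MonObj.one_comp]) hσ₂


end Elementary

/-! ## §1–§2 Untwisting an equivariant isomorphism of Serre fibres AT AN ITERATED BASE CHANGE -/

section UntwistBaseChange

variable {Y Y' Y'' : Scheme.{u}} (g : Y' ⟶ Y) {A : AbelianSchemeOver Y} {O : Type*} [CommRing O] (act : A.RingAction O) [IsCommMonObj A.X]
  {m : ℕ} (E' : Matrix (Fin m) (Fin m) O) (hE' : E' * E' = E') (P : Matrix (Fin m) (Fin 1) O) (Q : Matrix (Fin 1) (Fin m) O) {N : ℕ}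

/-- **THE KERNEL OF THE COVER LEG `c̄′ := (ψ′ ×_Y Y′) ×_{Y′} Y″` IS THE `𝔠`-TORSION OF THE SERRE FIBRE, SCHEME-THEORETICALLY** (`ψ′ = serreTranslateInv … Q`; `𝔠` a set of scalars
containing the entries of `Q`, each presented against `Q`): ★ `comp_serreTranslateInv_eq_one_iff_forall_comp_serreAction_i_eq_one` base-changed twice by ★ `idealKernelLaw_baseChangeHom` —
the twin of ★ `comp_coverLeg_eq_one_iff_forall_mem` for the other leg. [cite: Conrad2004GrossZagier, §7 (Thm. 7.5)] [cite: GortzWedhorn2020, Definition 4.45 (2) (p. 117)] -/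
theorem comp_coverInvLeg_eq_one_iff_forall_mem (s : Y'' ⟶ Y') (hQ : Q * E' = Q) (𝔠 : Set O) (hQ𝔠 : ∀ j k, Q j k ∈ 𝔠)
    (h𝔠 : ∀ a ∈ 𝔠, ∃ Pa : Matrix (Fin m) (Fin 1) O, E' * Pa = Pa ∧ Pa * Q = a • E')
    ⦃T : Over Y''⦄ (t : T ⟶ (((serreTensor act E' hE').baseChange g).baseChange s).X) :
    t ≫ baseChangeHom (baseChangeHom (serreTranslateInv act E' hE' Q) g) s = 1 ↔
      ∀ a ∈ 𝔠, t ≫ (((serreAction act E' hE').baseChange g).baseChange s).i a = 1 :=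
  idealKernelLaw_baseChangeHom s ((serreAction act E' hE').baseChange g) (baseChangeHom (serreTranslateInv act E' hE' Q) g) 𝔠
    (idealKernelLaw_baseChangeHom g (serreAction act E' hE') (serreTranslateInv act E' hE' Q) 𝔠
      (fun _ t₀ => comp_serreTranslateInv_eq_one_iff_forall_comp_serreAction_i_eq_one act E' hE' Q hQ 𝔠 hQ𝔠 h𝔠 t₀)) t

/-- **THE COVER LEG `c̄′` IS `𝒪`-EQUIVARIANT** (★ `i_comp_serreTranslateInv` base-changed twice). [cite: Kottwitz1992, §5 (p. 390)] [cite: Conrad2004GrossZagier, §7 (Thm. 7.5)] -/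
theorem i_comp_coverInvLeg (s : Y'' ⟶ Y') (hQ : Q * E' = Q) (a : O) :
    (((serreAction act E' hE').baseChange g).baseChange s).i a ≫ baseChangeHom (baseChangeHom (serreTranslateInv act E' hE' Q) g) s =
      baseChangeHom (baseChangeHom (serreTranslateInv act E' hE' Q) g) s ≫ ((act.baseChange g).baseChange s).i a :=
  i_baseChange_comp_baseChangeHom s ((serreAction act E' hE').baseChange g) (act.baseChange g) _ a
    (i_baseChange_comp_baseChangeHom g (serreAction act E' hE') act _ a (i_comp_serreTranslateInv act E' hE' Q hQ a))

include hE' in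
/-- **UNTWISTING AT AN ITERATED BASE CHANGE** (the twin of ★ `exists_iso_of_equivariant_serreTensor_iso` ∕ `serreTranslate_comp_eq_comp_serreTranslate_of_cover` for the fibres
`𝒞ᵢ := ((𝒜 ⊗ 𝔟) ×_Y Y′) ×_{Y′,sᵢ} Y″`, `Aᵢ := (𝒜 ×_Y Y′) ×_{Y′,sᵢ} Y″` at TWO base points `s₁ s₂ : Y″ → Y′`, WITHOUT re-reading the fibres as Serre tensors): `𝔟 = E′𝒪ᵐ` presented by
`(P, Q, N)` (`N ≠ 0`), `𝔠 ∋ Q j k` presented against `Q`.  For every isomorphism `ε : 𝒞₁ ≅ 𝒞₂` with `ε.hom` a homomorphism intertwining the iterated base changes of the Serre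
action there is `f : A₁ ≅ A₂`, `f.hom` a homomorphism, `𝒪`-EQUIVARIANT for the iterated base changes of `ι`, with **`c̄′₁ ≫ f = ε ≫ c̄′₂`** (covers) and **`c̄₁ ≫ ε = f ≫ c̄₂`**
(translations).  Proof: the covers have the intrinsic kernel `𝒞ᵢ[𝔠]` (`comp_coverInvLeg_eq_one_iff_forall_mem`), carried by `ε`, so ★ KER-EQ descends `f`; then `ψ′ψ_P = [N] = ψ_Pψ′`
base-changed and ★ `cancel_right_of_comp_eq_pow_id`. [cite: MumfordAV1970, §7 Thm. 4 (p. 72)] [cite: Conrad2004GrossZagier, §7 (Thm. 7.5)] [cite: MilneCM2006, §7 (Def. 7.19, Prop. 7.22, Rem. 7.23)] -/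
theorem exists_untwist_baseChange₂ (s₁ s₂ : Y'' ⟶ Y') (hN : N ≠ 0) (hP : E' * P = P) (hQ : Q * E' = Q)
    (hQP : Q * P = Matrix.scalar (Fin 1) (N : O)) (hPQ : P * Q = Matrix.scalar (Fin m) (N : O) * E')
    (𝔠 : Set O) (hQ𝔠 : ∀ j k, Q j k ∈ 𝔠) (h𝔠 : ∀ a ∈ 𝔠, ∃ Pa : Matrix (Fin m) (Fin 1) O, E' * Pa = Pa ∧ Pa * Q = a • E')
    (ε : (((serreTensor act E' hE').baseChange g).baseChange s₁).X ≅ (((serreTensor act E' hE').baseChange g).baseChange s₂).X) [IsMonHom ε.hom]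
    (hε : ∀ a, (((serreAction act E' hE').baseChange g).baseChange s₁).i a ≫ ε.hom = ε.hom ≫ (((serreAction act E' hE').baseChange g).baseChange s₂).i a) :
    ∃ f : ((A.baseChange g).baseChange s₁).X ≅ ((A.baseChange g).baseChange s₂).X, IsMonHom f.hom ∧
      (∀ a, ((act.baseChange g).baseChange s₁).i a ≫ f.hom = f.hom ≫ ((act.baseChange g).baseChange s₂).i a) ∧
      baseChangeHom (baseChangeHom (serreTranslateInv act E' hE' Q) g) s₁ ≫ f.hom =
        ε.hom ≫ baseChangeHom (baseChangeHom (serreTranslateInv act E' hE' Q) g) s₂ ∧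
      baseChangeHom (baseChangeHom (serreTranslate act E' hE' P) g) s₁ ≫ ε.hom =
        f.hom ≫ baseChangeHom (baseChangeHom (serreTranslate act E' hE' P) g) s₂ := by
  -- the four legs are homomorphisms
  haveI := isMonHom_serreTranslateInv act E' hE' Q
  haveI : IsMonHom (baseChangeHom (serreTranslateInv act E' hE' Q) g) := isMonHom_baseChangeHom _ g
  haveI : IsMonHom (baseChangeHom (baseChangeHom (serreTranslateInv act E' hE' Q) g) s₁) := isMonHom_baseChangeHom _ s₁
  haveI : IsMonHom (baseChangeHom (baseChangeHom (serreTranslateInv act E' hE' Q) g) s₂) := isMonHom_baseChangeHom _ s₂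
  haveI := isMonHom_coverLeg g s₁ act E' hE' P
  haveI := isMonHom_coverLeg g s₂ act E' hE' P
  -- the covers are fppf
  haveI := flat_serreTranslateInv_left act E' hE' Q P hN hP hQ hQP hPQ
  haveI := surjective_serreTranslateInv_left act E' hE' Q P hN hP hQ hQP hPQ
  haveI := isFinite_serreTranslateInv_left act E' hE' Q P hN hP hQ hQP hPQ
  haveI := flat_baseChangeHom_left g (serreTranslateInv act E' hE' Q)
  haveI := surjective_baseChangeHom_left g (serreTranslateInv act E' hE' Q)
  haveI := isFinite_baseChangeHom_left g (serreTranslateInv act E' hE' Q)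
  haveI := flat_baseChangeHom_left s₁ (baseChangeHom (serreTranslateInv act E' hE' Q) g)
  haveI := surjective_baseChangeHom_left s₁ (baseChangeHom (serreTranslateInv act E' hE' Q) g)
  haveI := isFinite_baseChangeHom_left s₁ (baseChangeHom (serreTranslateInv act E' hE' Q) g)
  haveI := flat_baseChangeHom_left s₂ (baseChangeHom (serreTranslateInv act E' hE' Q) g)
  haveI := surjective_baseChangeHom_left s₂ (baseChangeHom (serreTranslateInv act E' hE' Q) g)
  haveI := isFinite_baseChangeHom_left s₂ (baseChangeHom (serreTranslateInv act E' hE' Q) g)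
  haveI : Flat (ε.hom ≫ baseChangeHom (baseChangeHom (serreTranslateInv act E' hE' Q) g) s₂).left := by rw [Over.comp_left]; infer_instance
  haveI : Surjective (ε.hom ≫ baseChangeHom (baseChangeHom (serreTranslateInv act E' hE' Q) g) s₂).left := by rw [Over.comp_left]; infer_instance
  haveI : QuasiCompact (ε.hom ≫ baseChangeHom (baseChangeHom (serreTranslateInv act E' hE' Q) g) s₂).left := by rw [Over.comp_left]; infer_instance
  -- the kernels of `c̄′₁` and of `ε ≫ c̄′₂` agree: both say «killed by `𝔠`»
  have hker : ∀ ⦃T : Over Y''⦄ (t : T ⟶ (((serreTensor act E' hE').baseChange g).baseChange s₁).X),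
      t ≫ baseChangeHom (baseChangeHom (serreTranslateInv act E' hE' Q) g) s₁ = 1 ↔
        t ≫ (ε.hom ≫ baseChangeHom (baseChangeHom (serreTranslateInv act E' hE' Q) g) s₂) = 1 := by
    intro T t
    rw [comp_coverInvLeg_eq_one_iff_forall_mem g act E' hE' Q s₁ hQ 𝔠 hQ𝔠 h𝔠 t, ← Category.assoc,
      comp_coverInvLeg_eq_one_iff_forall_mem g act E' hE' Q s₂ hQ 𝔠 hQ𝔠 h𝔠 (t ≫ ε.hom)]
    refine forall₂_congr fun a _ => ?_
    rw [Category.assoc, ← hε a, ← Category.assoc, comp_iso_hom_eq_one_iff']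
  -- ★ KER-EQ: descend
  obtain ⟨f, hf, hmon, hequiv, -⟩ := exists_iso_comp_eq_equivariant_of_comp_eq_one_iff
    (A := ((serreTensor act E' hE').baseChange g).baseChange s₁)
    (baseChangeHom (baseChangeHom (serreTranslateInv act E' hE' Q) g) s₁)
    (ε.hom ≫ baseChangeHom (baseChangeHom (serreTranslateInv act E' hE' Q) g) s₂)
    (((serreAction act E' hE').baseChange g).baseChange s₁) ((act.baseChange g).baseChange s₂) ((act.baseChange g).baseChange s₁)
    (fun a => i_comp_coverInvLeg g act E' hE' Q s₁ hQ a)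
    (fun a => by rw [← Category.assoc, hε a, Category.assoc, i_comp_coverInvLeg g act E' hE' Q s₂ hQ a, Category.assoc])
    hker
  haveI := hmon
  refine ⟨f, hmon, hequiv, hf, ?_⟩
  -- the translations: cancel `[N]` (`c̄′₂ ≫ c̄₂ = [N]`; `c̄ᵢ ≫ c̄′ᵢ = [N]`)
  have hc'c : baseChangeHom (baseChangeHom (serreTranslateInv act E' hE' Q) g) s₂ ≫ baseChangeHom (baseChangeHom (serreTranslate act E' hE' P) g) s₂ =
      (𝟙 _) ^ N :=
    baseChangeHom_comp_eq_pow_id_of_comp_eq_pow_id s₂ _ _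
      (baseChangeHom_comp_eq_pow_id_of_comp_eq_pow_id g _ _ (serreTranslateInv_comp_serreTranslate act E' hE' P Q hP hQ hPQ))
  have hcc'₁ : baseChangeHom (baseChangeHom (serreTranslate act E' hE' P) g) s₁ ≫ baseChangeHom (baseChangeHom (serreTranslateInv act E' hE' Q) g) s₁ =
      (𝟙 _) ^ N :=
    baseChangeHom_comp_eq_pow_id_of_comp_eq_pow_id s₁ _ _
      (baseChangeHom_comp_eq_pow_id_of_comp_eq_pow_id g _ _ (serreTranslate_comp_serreTranslateInv act E' hE' P Q hP hQ hQP))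
  have hcc'₂ : baseChangeHom (baseChangeHom (serreTranslate act E' hE' P) g) s₂ ≫ baseChangeHom (baseChangeHom (serreTranslateInv act E' hE' Q) g) s₂ =
      (𝟙 _) ^ N :=
    baseChangeHom_comp_eq_pow_id_of_comp_eq_pow_id s₂ _ _
      (baseChangeHom_comp_eq_pow_id_of_comp_eq_pow_id g _ _ (serreTranslate_comp_serreTranslateInv act E' hE' P Q hP hQ hQP))
  refine cancel_right_of_comp_eq_pow_id ((A.baseChange g).baseChange s₁) (baseChangeHom (baseChangeHom (serreTranslateInv act E' hE' Q) g) s₂)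
    (baseChangeHom (baseChangeHom (serreTranslate act E' hE' P) g) s₂) hN hc'c _ _ ?_
  rw [Category.assoc, ← hf, ← Category.assoc, hcc'₁, Category.assoc, hcc'₂, comp_pow_id_eq_pow_id_comp _ f.hom N]


end UntwistBaseChange

/-! ## §3 Exactness descends along the untwist -/

section ExactnessDescends

/-- **EXACTNESS DESCENDS ALONG THE UNTWIST** (any base): `cᵢ : Aᵢ → Cᵢ` homomorphisms, `ε : C₁ ⥲ C₂`, `f : A₁ ⥲ A₂` homomorphisms with `c₁ ≫ ε = f ≫ c₂`; if the `cᵢ` pull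
`λ_Bᵢ : Cᵢ → B̂ᵢ` back to `λᵢ ≫ [p]` (`p ≠ 0`) and `ε` is exact on `(λ_B₁, λ_B₂)` then `f` is exact on `(λ₁, λ₂)`: `f ≫ λ₂ ≫ f^∨ = λ₁`.  (Both sides followed by `[p]` equal
`c₁ ≫ λ_B₁ ≫ c₁^∨` — ★ `dualIsogenyOver_comp` twice, `[p]` commutes with the homomorphism `f^∨` — and `[p]` cancels on the right, ★ `cancel_right_of_comp_eq_pow_id`.)  The homomorphism
property of `f^∨` is a binder (over a reduced locally Noetherian base it is ★ `DualPair.isMonHom_dualIsogenyOver`). [cite: MumfordAV1970, §15 Thm. 1 (p. 143); §23 (p. 231)]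
[cite: MumfordFogartyKirwan1994, Ch. 6 §2 Definition 6.3 (p. 120)] -/
theorem comp_lam_comp_dualIsogenyOver_eq_of_untwist {S₀ : Scheme.{u}} {A₁ A₂ C₁ C₂ : AbelianSchemeOver S₀}
    (c₁ : A₁.X ⟶ C₁.X) [IsMonHom c₁] (c₂ : A₂.X ⟶ C₂.X) [IsMonHom c₂]
    (ε : C₁.X ≅ C₂.X) [IsMonHom ε.hom] (f : A₁.X ≅ A₂.X) [IsMonHom f.hom] (hf : c₁ ≫ ε.hom = f.hom ≫ c₂)
    (DA₁ : A₁.DualPair) (DA₂ : A₂.DualPair) (DB₁ : C₁.DualPair) (DB₂ : C₂.DualPair)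
    (lam₁ : A₁.X ⟶ DA₁.hat.X) [IsMonHom lam₁] (lam₂ : A₂.X ⟶ DA₂.hat.X) [IsMonHom lam₂]
    (lamB₁ : C₁.X ⟶ DB₁.hat.X) (lamB₂ : C₂.X ⟶ DB₂.hat.X) [IsMonHom (DualPair.dualIsogenyOver f.hom DA₁ DA₂)] {p : ℕ} (hp : p ≠ 0)
    (hex₁ : c₁ ≫ lamB₁ ≫ DualPair.dualIsogenyOver c₁ DA₁ DB₁ = lam₁ ≫ DA₁.hat.mulN p)
    (hex₂ : c₂ ≫ lamB₂ ≫ DualPair.dualIsogenyOver c₂ DA₂ DB₂ = lam₂ ≫ DA₂.hat.mulN p)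
    (hlam : ε.hom ≫ lamB₂ ≫ DualPair.dualIsogenyOver ε.hom DB₁ DB₂ = lamB₁) :
    f.hom ≫ lam₂ ≫ DualPair.dualIsogenyOver f.hom DA₁ DA₂ = lam₁ := by
  -- `[p]` commutes with the homomorphism `f^∨`
  have hcomm : DualPair.dualIsogenyOver f.hom DA₁ DA₂ ≫ DA₁.hat.mulN p = DA₂.hat.mulN p ≫ DualPair.dualIsogenyOver f.hom DA₁ DA₂ := by
    rw [mulN_def, mulN_def, comp_pow_id_eq_pow_id_comp DA₂.hat (DualPair.dualIsogenyOver f.hom DA₁ DA₂) p]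
  -- the pull-back of `λ_B₂` along `f ≫ c₂ = c₁ ≫ ε`
  have hpull : (f.hom ≫ c₂) ≫ lamB₂ ≫ DualPair.dualIsogenyOver (f.hom ≫ c₂) DA₁ DB₂ =
      (c₁ ≫ ε.hom) ≫ lamB₂ ≫ DualPair.dualIsogenyOver (c₁ ≫ ε.hom) DA₁ DB₂ := by
    rw [DualPair.dualIsogenyOver_congr DA₁ DB₂ (ψ₁ := c₁ ≫ ε.hom) (ψ₂ := f.hom ≫ c₂) (h₂ := inferInstance) hf, hf]
  have key : (f.hom ≫ lam₂ ≫ DualPair.dualIsogenyOver f.hom DA₁ DA₂) ≫ DA₁.hat.mulN p = lam₁ ≫ DA₁.hat.mulN p :=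
    calc (f.hom ≫ lam₂ ≫ DualPair.dualIsogenyOver f.hom DA₁ DA₂) ≫ DA₁.hat.mulN p
        = f.hom ≫ lam₂ ≫ (DualPair.dualIsogenyOver f.hom DA₁ DA₂ ≫ DA₁.hat.mulN p) := by simp only [Category.assoc]
      _ = f.hom ≫ (lam₂ ≫ DA₂.hat.mulN p) ≫ DualPair.dualIsogenyOver f.hom DA₁ DA₂ := by rw [hcomm]; simp only [Category.assoc]
      _ = f.hom ≫ (c₂ ≫ lamB₂ ≫ DualPair.dualIsogenyOver c₂ DA₂ DB₂) ≫ DualPair.dualIsogenyOver f.hom DA₁ DA₂ := by rw [hex₂]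
      _ = (f.hom ≫ c₂) ≫ lamB₂ ≫ (DualPair.dualIsogenyOver c₂ DA₂ DB₂ ≫ DualPair.dualIsogenyOver f.hom DA₁ DA₂) := by simp only [Category.assoc]
      _ = (f.hom ≫ c₂) ≫ lamB₂ ≫ DualPair.dualIsogenyOver (f.hom ≫ c₂) DA₁ DB₂ := by rw [DualPair.dualIsogenyOver_comp f.hom c₂ DA₁ DA₂ DB₂]
      _ = (c₁ ≫ ε.hom) ≫ lamB₂ ≫ DualPair.dualIsogenyOver (c₁ ≫ ε.hom) DA₁ DB₂ := hpull
      _ = c₁ ≫ (ε.hom ≫ lamB₂ ≫ DualPair.dualIsogenyOver ε.hom DB₁ DB₂) ≫ DualPair.dualIsogenyOver c₁ DA₁ DB₁ := by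
          rw [DualPair.dualIsogenyOver_comp c₁ ε.hom DA₁ DB₁ DB₂]; simp only [Category.assoc]
      _ = c₁ ≫ lamB₁ ≫ DualPair.dualIsogenyOver c₁ DA₁ DB₁ := by rw [hlam]
      _ = lam₁ ≫ DA₁.hat.mulN p := hex₁
  rw [mulN_def] at key
  exact cancel_right_of_comp_eq_pow_id A₁ ((𝟙 DA₁.hat.X) ^ p) (𝟙 DA₁.hat.X) hp (by rw [Category.comp_id]) _ _ key


end ExactnessDescends

end AbelianSchemeOver

end Literature.AlgebraicGeometry.AbelianSchemes

end
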